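import Summits.QuantumFields.BalabanUV.Beta.CapRowsTail
import Summits.QuantumFields.BalabanUV.Beta.CapAnchorBudget
import Literature.MathematicalPhysics.QuantumFieldTheory.Balaban1983to89.Beta.AliasingTailLattice
import Summits.QuantumFields.BalabanUV.Beta.PolyRegularAlgebra

/-!
# Beta / CapRowsLattice — BINDER-OWNERS row CAP-k, item (b): the `k₀ = 0` anchor from a LATTICE RULE (sampling set ∕ code16 ∕ code16E)
# (β sub-cell, DEDICATED row BETA-an5, lineage `b2b-balaban-beta-an5` = OWNER of row CAP-k; gen 20, prover seat)

HONEST FRAMING (page 1 of everything the β sub-cell writes): discharging `BetaPertH` makes Bałaban's UV stability UNCONDITIONAL — a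
real constructive-QFT result; it is NOT the continuum limit and NOT the Clay problem.  HONEST DEPENDENCY (cell reorg 2026-08-19, verbatim):
«continuum YM on T⁴ ⇐ BetaPertH ∧ nine spine estimates (0/9 proved); BetaPertH ⇐ (D1) ∧ (D4) ∧ CAP+tail; G-an2-4 gates asym, D1 and NE2/3/4.»
THIS MODULE INSTANTIATES NO BINDER; no integrand `G`, no period, no engine number enters.  It is the row-CAP-k consumer that cap3-g7 asked
for by name (cell file BETA/CAP-KERNEL.md v0.6.0 §4.13 (f) «an5 — `Rows.ofAliasingLattice`/CapRows consumer of `lo_le_of_aliasing_code16`»)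
of the LATTICE-RULE leaf `Literature.….Beta.AliasingTailLattice` (p202341/p202522): the grid mean of the one-loop integrand over a
SAMPLING SET `S ⊆ (ℤ/P)^{d+1}` (`0 ∈ S`, `S + S ⊆ S`) differs from the coefficient `latticeKernel G 0` by at most `M·Θ_S(κ)` with
`Θ_S(κ) = Σ_{y ∈ S^⊥ ∖ 0} e^{−κ|y|₁}` governed by the `ℓ¹`-minimum of the DUAL lattice; the four-dimensional code16 rule `code16Set N`
(`16N⁴` of the `(4N)⁴` grid points, dual minimum `4N`) has `Θ ≤ codeTheta (e^{−κN}) = 36ρ⁴ + 48ρ⁶ + O(ρ⁸)`.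

CONTENTS.
 §1 THE ANCHOR ROWS in the binf-free currency of `CapRows` (shape of `CapRows.Rows.ofAliasingL1`, `k₀ = 0`, `lo 0 = lo`):
    `rowsOfSampling` (any sampling set, tail `M·theta S κ ≤ A` — literally `AliasingTailLattice.lo_le_of_aliasing_sampling`),
    `rowsOfSamplingMajorant` (tail through any proved majorant `theta S κ ≤ Θ`), `rowsOfCode16` (`d = 3`, `S = code16Set N` — the TREE
    convention, literally `lo_le_of_aliasing_code16`), `rowsOfCode16E` (`S = code16SetE N` — the ENGINE convention of cap5's `JOB_QRULE=code16`,
    literally `lo_le_of_aliasing_code16E`; CONSUMER RULE of CAP-KERNEL §4.13 (g): a certificate produced on `code16SetE` feeds the `E` row, one on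
    `code16Set` the plain row), tails `M·codeTheta (aliasRatioL1 κ N) ≤ A` in both, their constants, and the certified-road ENDs
    `betaAvgAFH_of_anchorCode16` ∕ `betaAvgAFH_of_anchorCode16E` (= `CapRows.betaAvgAFH_of_capRows` on the row; the feasibility conditions of
    `CapRows` §4 apply verbatim).
 §2 THE TWO-SIDED DATUM and the ONE-SHOT contraction ENDs on the lattice-rule anchor (twins of `CapRowsTail` §5–§6:
    `latticeKernel_zero_re_le_sampling`, `datum_of_aliasingSampling`, `betaAvgAFH_of_anchorSampling_contracting`,
    `betaAvgAFH_of_anchorCode16_contracting`, `betaAvgAFH_of_anchorCode16E_contracting`).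
 §3 (v1.1, APPEND-ONLY) THE MARGIN-road ENDs (no `hk₂`): `betaAvgAFH_of_rows_margin` (any `Rows`), `betaAvgAFH_of_anchorCode16(E)_margin`.
 §4 (v1.2, APPEND-ONLY) THE ROW'S TYPED TARGET IN ONE SIGNATURE: `rowsOfOneLoopFormCode16E` ∕ `betaAvgAFH_of_oneLoopFormCode16E` = §1 ∘ cap3-g8's
    `PolyRegularAlgebra.stripRegularC_oneLoopForm` (structure ⊕ (Z1) ⊕ (Z2) certificates ⊕ (T) ⊕ (A) ⊕ cmp ⊕ (N), every binder named by kind).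
 The BUDGET (kernel-evaluated `codeTheta` majorants, admissible certified sup bounds per period, the `N = 2` negative) is the sibling leaf
 `CapLatticeBudget`.

ABSOLUTE RULE (cell charter, verbatim): "No internally-minted statement may enter as a cited fact. Every hypothesis is either
kernel-proved in this package or a verbatim quotation of a PUBLISHED theorem with page reference. The manuscript(s) under audit are
NOT citable for their own disputed steps — they are the thing under adjudication; programme-internal (2001/route/tribunal) claims
are never citable."  Nothing is cited here; every statement is bookkeeping over the tree's own leaves. [folklore]
-/

namespace Summit.QuantumFields.BalabanUV.Beta.CapRowsLattice

open Literature.MathematicalPhysics.QuantumFieldTheory.Balaban1983to89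
open Literature.MathematicalPhysics.QuantumFieldTheory.Balaban1983to89.Beta
open FlowStep FlowStepRuns DagBinding
open B4ContourShift (latticeKernel StripRegular)
open B4TorusKernel (descend gridPt)
open Beta.RemainderChain (RemainderConst)
open Beta.RateCertificate (GeomRate)
open Beta.AveragedAFCarrier (BetaAvgAFH)
open Beta.AliasingTailL1 (StripRegularC aliasRatioL1)
open Beta.AliasingTailLattice (theta codeTheta code16Set zero_mem_code16Set add_mem_code16Set theta_code16_le code16SetE
  zero_mem_code16SetE add_mem_code16SetE theta_code16E_le lo_le_of_aliasing_sampling lo_le_of_aliasing_code16 lo_le_of_aliasing_code16E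
  norm_samplingMean_sub_latticeKernel_zero_le)
open Summit.QuantumFields.BalabanUV.Beta.CapRows
open Summit.QuantumFields.BalabanUV.Beta.CapRowsTail (ContractingTail re_le_of_enclosures abs_sub_le_of_enclosures
  betaAvgAFH_of_rows_contractingTail)
open Summit.QuantumFields.BalabanUV.Beta.CapAnchorBudget (stripBound_nonneg)

/-! ## §1 The anchor rows from a lattice rule -/

section Anchor

variable {d P : ℕ} {b : ℕ → ℝ}

/-- the tail through a majorant: `StripRegularC G κ M` gives `0 ≤ M`, so `theta S κ ≤ Θ` and `M·Θ ≤ A` give `M·theta S κ ≤ A`. [folklore] -/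
theorem tail_le_of_majorant {G : (Fin (d + 1) → ℂ) → ℂ} {κ M Θ A : ℝ} (h : StripRegularC G κ M) (hκ : 0 < κ)
    (S : Finset (Fin (d + 1) → Fin P)) (hΘ : theta S κ ≤ Θ) (hA : M * Θ ≤ A) : M * theta S κ ≤ A :=
  le_trans (mul_le_mul_of_nonneg_left hΘ (stripBound_nonneg (h.toStripRegular hκ.le) hκ.le)) hA

/-- **THE ANCHOR ROW FROM A SAMPLING SET.**  (N) the level-0 dictionary `b 0 = Re (latticeKernel G 0)` (a BINDER) + (Z) `StripRegularC G κ M`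
+ a sampling set `S ⊆ (ℤ/P)^{d+1}` with `0 ∈ S`, `S + S ⊆ S` + (T) an engine ball `‖|S|⁻¹ Σ_{w ∈ S} G(2π rep(w/P)) − t‖ ≤ r` + (A) a tail
majorant `M·theta S κ ≤ A` + ONE rational comparison `lo ≤ t − r − A` ⟹ `Rows b` with `k₀ = 0`, `lo 0 = lo`
(literally `AliasingTailLattice.lo_le_of_aliasing_sampling`). [folklore] -/
def rowsOfSampling [NeZero P] {G : (Fin (d + 1) → ℂ) → ℂ} {κ M : ℝ} (hb : b 0 = (latticeKernel G 0).re)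
    (h : StripRegularC G κ M) (hκ : 0 < κ) (S : Finset (Fin (d + 1) → Fin P))
    (h0 : (0 : Fin (d + 1) → Fin P) ∈ S) (hadd : ∀ k ∈ S, ∀ w ∈ S, k + w ∈ S) {t r : ℝ}
    (hT : ‖(S.card : ℂ)⁻¹ * (∑ w ∈ S, descend G (gridPt P w)) - t‖ ≤ r)
    {A : ℝ} (hA : M * theta S κ ≤ A) (lo : ℚ) (hlo : ((lo : ℚ) : ℝ) ≤ t - r - A) : Rows b where
  k₀ := 0
  lo := fun _ => lo
  lo_le k hk := by
    obtain rfl : k = 0 := Nat.le_zero.mp hk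
    rw [hb]
    exact lo_le_of_aliasing_sampling h hκ S h0 hadd hT hA hlo

/-- its constants: `k₀ = 0`, `m = m₀ = lo`. [folklore] -/
theorem rowsOfSampling_consts [NeZero P] {G : (Fin (d + 1) → ℂ) → ℂ} {κ M : ℝ} (hb : b 0 = (latticeKernel G 0).re)
    (h : StripRegularC G κ M) (hκ : 0 < κ) (S : Finset (Fin (d + 1) → Fin P))
    (h0 : (0 : Fin (d + 1) → Fin P) ∈ S) (hadd : ∀ k ∈ S, ∀ w ∈ S, k + w ∈ S) {t r : ℝ}
    (hT : ‖(S.card : ℂ)⁻¹ * (∑ w ∈ S, descend G (gridPt P w)) - t‖ ≤ r)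
    {A : ℝ} (hA : M * theta S κ ≤ A) (lo : ℚ) (hlo : ((lo : ℚ) : ℝ) ≤ t - r - A) :
    (rowsOfSampling hb h hκ S h0 hadd hT hA lo hlo).k₀ = 0 ∧ (rowsOfSampling hb h hκ S h0 hadd hT hA lo hlo).m = lo ∧
      (rowsOfSampling hb h hκ S h0 hadd hT hA lo hlo).m₀ = lo := by
  refine ⟨rfl, rfl, ?_⟩
  simp [Rows.m₀, rowsOfSampling]

/-- **… THROUGH A PROVED MAJORANT** `theta S κ ≤ Θ` (the shape for cap3's node-set conventions: `theta_code16_le`, resp. the `code16SetE`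
twin, supply `Θ = codeTheta (aliasRatioL1 κ N)`): (A) becomes `M·Θ ≤ A`. [folklore] -/
def rowsOfSamplingMajorant [NeZero P] {G : (Fin (d + 1) → ℂ) → ℂ} {κ M : ℝ} (hb : b 0 = (latticeKernel G 0).re)
    (h : StripRegularC G κ M) (hκ : 0 < κ) (S : Finset (Fin (d + 1) → Fin P))
    (h0 : (0 : Fin (d + 1) → Fin P) ∈ S) (hadd : ∀ k ∈ S, ∀ w ∈ S, k + w ∈ S) {t r : ℝ}
    (hT : ‖(S.card : ℂ)⁻¹ * (∑ w ∈ S, descend G (gridPt P w)) - t‖ ≤ r)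
    {Θ A : ℝ} (hΘ : theta S κ ≤ Θ) (hA : M * Θ ≤ A) (lo : ℚ) (hlo : ((lo : ℚ) : ℝ) ≤ t - r - A) : Rows b :=
  rowsOfSampling hb h hκ S h0 hadd hT (tail_le_of_majorant h hκ S hΘ hA) lo hlo

/-- **THE ANCHOR ROW FROM THE CODE16 RULE** (`d = 3`): (N) + (Z) `StripRegularC G κ M` + (T) an engine ball for the mean of `G` over the
`16N⁴` nodes `2π·w/(4N)`, `w ∈ code16Set N` + (A) `M·codeTheta (aliasRatioL1 κ N) ≤ A` + `lo ≤ t − r − A` ⟹ `Rows b` with `k₀ = 0`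
(literally `AliasingTailLattice.lo_le_of_aliasing_code16`). [folklore] -/
def rowsOfCode16 {G : (Fin 4 → ℂ) → ℂ} {κ M : ℝ} (hb : b 0 = (latticeKernel G 0).re) (h : StripRegularC G κ M)
    (hκ : 0 < κ) {N : ℕ} (hN : 1 ≤ N) [NeZero (4 * N)] {t r : ℝ}
    (hT : ‖((code16Set N).card : ℂ)⁻¹ * (∑ w ∈ code16Set N, descend G (gridPt (4 * N) w)) - t‖ ≤ r)
    {A : ℝ} (hA : M * codeTheta (aliasRatioL1 κ N) ≤ A) (lo : ℚ) (hlo : ((lo : ℚ) : ℝ) ≤ t - r - A) : Rows b where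
  k₀ := 0
  lo := fun _ => lo
  lo_le k hk := by
    obtain rfl : k = 0 := Nat.le_zero.mp hk
    rw [hb]
    exact lo_le_of_aliasing_code16 h hκ hN hT hA hlo

/-- its constants: `k₀ = 0`, `m = m₀ = lo`. [folklore] -/
theorem rowsOfCode16_consts {G : (Fin 4 → ℂ) → ℂ} {κ M : ℝ} (hb : b 0 = (latticeKernel G 0).re) (h : StripRegularC G κ M)
    (hκ : 0 < κ) {N : ℕ} (hN : 1 ≤ N) [NeZero (4 * N)] {t r : ℝ}
    (hT : ‖((code16Set N).card : ℂ)⁻¹ * (∑ w ∈ code16Set N, descend G (gridPt (4 * N) w)) - t‖ ≤ r)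
    {A : ℝ} (hA : M * codeTheta (aliasRatioL1 κ N) ≤ A) (lo : ℚ) (hlo : ((lo : ℚ) : ℝ) ≤ t - r - A) :
    (rowsOfCode16 hb h hκ hN hT hA lo hlo).k₀ = 0 ∧ (rowsOfCode16 hb h hκ hN hT hA lo hlo).m = lo ∧
      (rowsOfCode16 hb h hκ hN hT hA lo hlo).m₀ = lo := by
  refine ⟨rfl, rfl, ?_⟩
  simp [Rows.m₀, rowsOfCode16]

/-- the code16 tail majorant also bounds the exact tail of the node set: `M·theta (code16Set N) κ ≤ A`. [folklore] -/
theorem tail_code16_le {G : (Fin 4 → ℂ) → ℂ} {κ M : ℝ} (h : StripRegularC G κ M) (hκ : 0 < κ) {N : ℕ} (hN : 1 ≤ N)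
    {A : ℝ} (hA : M * codeTheta (aliasRatioL1 κ N) ≤ A) : M * theta (code16Set N) κ ≤ A :=
  tail_le_of_majorant h hκ (code16Set N) (theta_code16_le hN hκ) hA

/-- **THE ANCHOR ROW FROM THE CODE16 RULE, ENGINE CONVENTION** (`S = code16SetE N`, cap5's `JOB_QRULE=code16` node set
`{w : 4 ∣ w₀ + 2w₁ + w₂ ∧ 4 ∣ 2w₀ + w₁ + w₃}` — the same `16N⁴` nodes up to a signed coordinate permutation, the same tail): (N) + (Z) + (T) an engine
ball for the mean over `code16SetE N` + (A) `M·codeTheta (aliasRatioL1 κ N) ≤ A` + `lo ≤ t − r − A` ⟹ `Rows b` with `k₀ = 0`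
(literally `AliasingTailLattice.lo_le_of_aliasing_code16E`). [folklore] -/
def rowsOfCode16E {G : (Fin 4 → ℂ) → ℂ} {κ M : ℝ} (hb : b 0 = (latticeKernel G 0).re) (h : StripRegularC G κ M)
    (hκ : 0 < κ) {N : ℕ} (hN : 1 ≤ N) [NeZero (4 * N)] {t r : ℝ}
    (hT : ‖((code16SetE N).card : ℂ)⁻¹ * (∑ w ∈ code16SetE N, descend G (gridPt (4 * N) w)) - t‖ ≤ r)
    {A : ℝ} (hA : M * codeTheta (aliasRatioL1 κ N) ≤ A) (lo : ℚ) (hlo : ((lo : ℚ) : ℝ) ≤ t - r - A) : Rows b where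
  k₀ := 0
  lo := fun _ => lo
  lo_le k hk := by
    obtain rfl : k = 0 := Nat.le_zero.mp hk
    rw [hb]
    exact lo_le_of_aliasing_code16E h hκ hN hT hA hlo

/-- its constants: `k₀ = 0`, `m = m₀ = lo`. [folklore] -/
theorem rowsOfCode16E_consts {G : (Fin 4 → ℂ) → ℂ} {κ M : ℝ} (hb : b 0 = (latticeKernel G 0).re) (h : StripRegularC G κ M)
    (hκ : 0 < κ) {N : ℕ} (hN : 1 ≤ N) [NeZero (4 * N)] {t r : ℝ}
    (hT : ‖((code16SetE N).card : ℂ)⁻¹ * (∑ w ∈ code16SetE N, descend G (gridPt (4 * N) w)) - t‖ ≤ r)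
    {A : ℝ} (hA : M * codeTheta (aliasRatioL1 κ N) ≤ A) (lo : ℚ) (hlo : ((lo : ℚ) : ℝ) ≤ t - r - A) :
    (rowsOfCode16E hb h hκ hN hT hA lo hlo).k₀ = 0 ∧ (rowsOfCode16E hb h hκ hN hT hA lo hlo).m = lo ∧
      (rowsOfCode16E hb h hκ hN hT hA lo hlo).m₀ = lo := by
  refine ⟨rfl, rfl, ?_⟩
  simp [Rows.m₀, rowsOfCode16E]

/-- the code16 tail majorant bounds the exact tail of the engine-convention node set: `M·theta (code16SetE N) κ ≤ A`. [folklore] -/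
theorem tail_code16E_le {G : (Fin 4 → ℂ) → ℂ} {κ M : ℝ} (h : StripRegularC G κ M) (hκ : 0 < κ) {N : ℕ} (hN : 1 ≤ N)
    {A : ℝ} (hA : M * codeTheta (aliasRatioL1 κ N) ≤ A) : M * theta (code16SetE N) κ ≤ A :=
  tail_le_of_majorant h hκ (code16SetE N) (theta_code16E_le hN hκ) hA

variable {β : HBeta}

/-- **THE CERTIFIED ROAD FROM THE CODE16 ANCHOR**: anchor row + rate `GeomRate` + the rate-side comparison `hk₂` at `k₀ = 0` + constant
remainder ⟹ `BetaAvgAFH (min lo (3(lo − c₀)/4) − r′) 0 γ₀ β` (`CapRows.betaAvgAFH_of_capRows` on the row; by `CapRows` §4 only ever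
inhabited when `(1 + 4θ)|β⁰₁ − β∞| ≤ lo`). [folklore] -/
theorem betaAvgAFH_of_anchorCode16 (S : B12Beta.OneLoopSplit β) {G : (Fin 4 → ℂ) → ℂ} {κ M : ℝ}
    (hb : S.β0 0 = (latticeKernel G 0).re) (h : StripRegularC G κ M) (hκ : 0 < κ) {N : ℕ} (hN : 1 ≤ N) [NeZero (4 * N)]
    {t rT : ℝ} (hT : ‖((code16Set N).card : ℂ)⁻¹ * (∑ w ∈ code16Set N, descend G (gridPt (4 * N) w)) - t‖ ≤ rT)
    {A : ℝ} (hA : M * codeTheta (aliasRatioL1 κ N) ≤ A) (lo : ℚ) (hlo : ((lo : ℚ) : ℝ) ≤ t - rT - A)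
    {γ₀ binf c₀ θ r : ℝ} (hθ0 : 0 ≤ θ) (hθ1 : θ ≤ 1) (hconv : GeomRate S.β0 binf c₀ θ)
    (hk₂ : c₀ * θ ^ (0 + 1) ≤ ((lo : ℝ) - c₀ * θ ^ 0) / 4) (hrem : RemainderConst S γ₀ r) :
    BetaAvgAFH (min ((lo : ℚ) : ℝ) (3 * ((lo : ℝ) - c₀ * θ ^ 0) / 4) - r) 0 γ₀ β := by
  have key := betaAvgAFH_of_capRows S (rowsOfCode16 hb h hκ hN hT hA lo hlo) hθ0 hθ1 hconv hk₂ hrem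
  rwa [(rowsOfCode16_consts hb h hκ hN hT hA lo hlo).2.2] at key

/-- **THE CERTIFIED ROAD FROM THE CODE16 ANCHOR, ENGINE CONVENTION** (`code16SetE`). [folklore] -/
theorem betaAvgAFH_of_anchorCode16E (S : B12Beta.OneLoopSplit β) {G : (Fin 4 → ℂ) → ℂ} {κ M : ℝ}
    (hb : S.β0 0 = (latticeKernel G 0).re) (h : StripRegularC G κ M) (hκ : 0 < κ) {N : ℕ} (hN : 1 ≤ N) [NeZero (4 * N)]
    {t rT : ℝ} (hT : ‖((code16SetE N).card : ℂ)⁻¹ * (∑ w ∈ code16SetE N, descend G (gridPt (4 * N) w)) - t‖ ≤ rT)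
    {A : ℝ} (hA : M * codeTheta (aliasRatioL1 κ N) ≤ A) (lo : ℚ) (hlo : ((lo : ℚ) : ℝ) ≤ t - rT - A)
    {γ₀ binf c₀ θ r : ℝ} (hθ0 : 0 ≤ θ) (hθ1 : θ ≤ 1) (hconv : GeomRate S.β0 binf c₀ θ)
    (hk₂ : c₀ * θ ^ (0 + 1) ≤ ((lo : ℝ) - c₀ * θ ^ 0) / 4) (hrem : RemainderConst S γ₀ r) :
    BetaAvgAFH (min ((lo : ℚ) : ℝ) (3 * ((lo : ℝ) - c₀ * θ ^ 0) / 4) - r) 0 γ₀ β := by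
  have key := betaAvgAFH_of_capRows S (rowsOfCode16E hb h hκ hN hT hA lo hlo) hθ0 hθ1 hconv hk₂ hrem
  rwa [(rowsOfCode16E_consts hb h hκ hN hT hA lo hlo).2.2] at key

end Anchor

/-! ## §2 The two-sided datum and the one-shot contraction END on the lattice-rule anchor -/

section Datum

variable {d P : ℕ}

/-- **UPPER HALF of the sampling leaf**: `Re (latticeKernel G 0) ≤ t + r + M·theta S κ` (twin of
`AliasingTailLattice.latticeKernel_zero_re_ge_sampling`). [folklore] -/
theorem latticeKernel_zero_re_le_sampling [NeZero P] {G : (Fin (d + 1) → ℂ) → ℂ} {κ M : ℝ} (h : StripRegularC G κ M)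
    (hκ : 0 < κ) (S : Finset (Fin (d + 1) → Fin P)) (h0 : (0 : Fin (d + 1) → Fin P) ∈ S)
    (hadd : ∀ k ∈ S, ∀ w ∈ S, k + w ∈ S) {t r : ℝ} (hT : ‖(S.card : ℂ)⁻¹ * (∑ w ∈ S, descend G (gridPt P w)) - t‖ ≤ r) :
    (latticeKernel G 0).re ≤ t + r + M * theta S κ :=
  re_le_of_enclosures hT (norm_samplingMean_sub_latticeKernel_zero_le h hκ S h0 hadd)

/-- **THE DATUM for (C) at `k₀ = 0` on the sampling anchor**: (N), (Z), the sampling set, (T), (A) `M·theta S κ ≤ A` and an enclosure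
`bl ≤ binf ≤ bh` of the limit value give `|b 0 − binf| ≤ max (t + r + A − bl) (bh − (t − r − A))`. [folklore] -/
theorem datum_of_aliasingSampling [NeZero P] {b : ℕ → ℝ} {G : (Fin (d + 1) → ℂ) → ℂ} {κ M : ℝ}
    (hb : b 0 = (latticeKernel G 0).re) (h : StripRegularC G κ M) (hκ : 0 < κ) (S : Finset (Fin (d + 1) → Fin P))
    (h0 : (0 : Fin (d + 1) → Fin P) ∈ S) (hadd : ∀ k ∈ S, ∀ w ∈ S, k + w ∈ S) {t r : ℝ}
    (hT : ‖(S.card : ℂ)⁻¹ * (∑ w ∈ S, descend G (gridPt P w)) - t‖ ≤ r) {A : ℝ} (hA : M * theta S κ ≤ A)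
    {binf bl bh : ℝ} (hbl : bl ≤ binf) (hbh : binf ≤ bh) :
    |b 0 - binf| ≤ max (t + r + A - bl) (bh - (t - r - A)) := by
  have hlo : t - r - A ≤ b 0 := by
    rw [hb]; have := Beta.AliasingTailLattice.latticeKernel_zero_re_ge_sampling h hκ S h0 hadd hT; linarith
  have hhi : b 0 ≤ t + r + A := by
    rw [hb]; have := latticeKernel_zero_re_le_sampling h hκ S h0 hadd hT; linarith
  exact abs_sub_le_of_enclosures hlo hhi hbl hbh

variable {β : HBeta}

/-- **ONE-SHOT END (contraction road, `k₀ = 0`, sampling anchor)**: (N) + (Z) + sampling set + (T) + (A) + `lo ≤ t − rT − A` + enclosure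
`bl ≤ binf ≤ bh` + `ContractingTail S.β0 binf θ 0` (`0 ≤ θ ≤ 1`) + `RemainderConst S γ₀ r` ⟹
`BetaAvgAFH (min lo (binf − θ·max (t + rT + A − bl) (bh − (t − rT − A))) − r) 0 γ₀ β` (twin of
`CapRowsTail.betaAvgAFH_of_anchorL1_contracting`; NO rate constant, NO sharp `θ`). [folklore] -/
theorem betaAvgAFH_of_anchorSampling_contracting [NeZero P] (S : B12Beta.OneLoopSplit β) {G : (Fin (d + 1) → ℂ) → ℂ} {κ M : ℝ}
    (hb : S.β0 0 = (latticeKernel G 0).re) (h : StripRegularC G κ M) (hκ : 0 < κ) (T : Finset (Fin (d + 1) → Fin P))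
    (h0 : (0 : Fin (d + 1) → Fin P) ∈ T) (hadd : ∀ k ∈ T, ∀ w ∈ T, k + w ∈ T) {t rT : ℝ}
    (hT : ‖(T.card : ℂ)⁻¹ * (∑ w ∈ T, descend G (gridPt P w)) - t‖ ≤ rT) {A : ℝ} (hA : M * theta T κ ≤ A)
    (lo : ℚ) (hlo : ((lo : ℚ) : ℝ) ≤ t - rT - A) {binf bl bh θ : ℝ} (hbl : bl ≤ binf) (hbh : binf ≤ bh) (hθ0 : 0 ≤ θ)
    (hθ1 : θ ≤ 1) (hcontr : ContractingTail S.β0 binf θ 0) {γ₀ r : ℝ} (hrem : RemainderConst S γ₀ r) :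
    BetaAvgAFH (min ((lo : ℚ) : ℝ) (binf - θ * max (t + rT + A - bl) (bh - (t - rT - A))) - r) 0 γ₀ β := by
  have hD := datum_of_aliasingSampling hb h hκ T h0 hadd hT hA hbl hbh
  have key := betaAvgAFH_of_rows_contractingTail S (rowsOfSampling hb h hκ T h0 hadd hT hA lo hlo) hcontr hθ0 hθ1 hD hrem
  rwa [(rowsOfSampling_consts hb h hκ T h0 hadd hT hA lo hlo).2.2] at key

/-- **ONE-SHOT END (contraction road, `k₀ = 0`, code16 anchor)**: the same on `code16Set N` with the tail `M·codeTheta (aliasRatioL1 κ N) ≤ A`.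
[folklore] -/
theorem betaAvgAFH_of_anchorCode16_contracting (S : B12Beta.OneLoopSplit β) {G : (Fin 4 → ℂ) → ℂ} {κ M : ℝ}
    (hb : S.β0 0 = (latticeKernel G 0).re) (h : StripRegularC G κ M) (hκ : 0 < κ) {N : ℕ} (hN : 1 ≤ N) [NeZero (4 * N)]
    {t rT : ℝ} (hT : ‖((code16Set N).card : ℂ)⁻¹ * (∑ w ∈ code16Set N, descend G (gridPt (4 * N) w)) - t‖ ≤ rT)
    {A : ℝ} (hA : M * codeTheta (aliasRatioL1 κ N) ≤ A) (lo : ℚ) (hlo : ((lo : ℚ) : ℝ) ≤ t - rT - A)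
    {binf bl bh θ : ℝ} (hbl : bl ≤ binf) (hbh : binf ≤ bh) (hθ0 : 0 ≤ θ) (hθ1 : θ ≤ 1)
    (hcontr : ContractingTail S.β0 binf θ 0) {γ₀ r : ℝ} (hrem : RemainderConst S γ₀ r) :
    BetaAvgAFH (min ((lo : ℚ) : ℝ) (binf - θ * max (t + rT + A - bl) (bh - (t - rT - A))) - r) 0 γ₀ β :=
  betaAvgAFH_of_anchorSampling_contracting S hb h hκ (code16Set N) zero_mem_code16Set
    (fun _ hk _ hw => add_mem_code16Set hk hw) hT (tail_code16_le h hκ hN hA) lo hlo hbl hbh hθ0 hθ1 hcontr hrem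

/-- **ONE-SHOT END (contraction road, `k₀ = 0`, code16 anchor, ENGINE CONVENTION `code16SetE`)**. [folklore] -/
theorem betaAvgAFH_of_anchorCode16E_contracting (S : B12Beta.OneLoopSplit β) {G : (Fin 4 → ℂ) → ℂ} {κ M : ℝ}
    (hb : S.β0 0 = (latticeKernel G 0).re) (h : StripRegularC G κ M) (hκ : 0 < κ) {N : ℕ} (hN : 1 ≤ N) [NeZero (4 * N)]
    {t rT : ℝ} (hT : ‖((code16SetE N).card : ℂ)⁻¹ * (∑ w ∈ code16SetE N, descend G (gridPt (4 * N) w)) - t‖ ≤ rT)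
    {A : ℝ} (hA : M * codeTheta (aliasRatioL1 κ N) ≤ A) (lo : ℚ) (hlo : ((lo : ℚ) : ℝ) ≤ t - rT - A)
    {binf bl bh θ : ℝ} (hbl : bl ≤ binf) (hbh : binf ≤ bh) (hθ0 : 0 ≤ θ) (hθ1 : θ ≤ 1)
    (hcontr : ContractingTail S.β0 binf θ 0) {γ₀ r : ℝ} (hrem : RemainderConst S γ₀ r) :
    BetaAvgAFH (min ((lo : ℚ) : ℝ) (binf - θ * max (t + rT + A - bl) (bh - (t - rT - A))) - r) 0 γ₀ β :=
  betaAvgAFH_of_anchorSampling_contracting S hb h hκ (code16SetE N) zero_mem_code16SetE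
    (fun _ hk _ hw => add_mem_code16SetE hk hw) hT (tail_code16E_le h hκ hN hA) lo hlo hbl hbh hθ0 hθ1 hcontr hrem

end Datum


/-! ## §3 (v1.1, APPEND-ONLY) The MARGIN-road ENDs on the rows and on the code16 anchor

The co-lead's margin road `AveragedAFCarrierCertified.betaAvgAFH_of_marginConst` takes the rate `GeomRate S.β0 binf c₀ θ` (`0 ≤ θ ≤ 1`), a
ONE-SIDED list `∀ k ≤ k₁, m ≤ S.β0 k` and the constant remainder, and gives `BetaAvgAFH (m − c₀θ^{k₁}(1+θ) − r) 0 γ₀ β` — no `hk₂`.  On a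
`CapRows.Rows` carrier the list is `hsmall` with `m := m₀`, `k₁ := k₀`; on the code16 anchor (`k₀ = 0`, `m₀ = lo`) the constant is
`lo − c₀(1 + θ) − r`, inhabited with a positive slope iff `c₀(1 + θ) + r < lo` (`CapRows.margin_necessary`: forces `(1+θ)|β⁰₁ − β∞| ≤ lo − r`). -/

section Margin

open Beta.AveragedAFCarrierCertified (betaAvgAFH_of_marginConst)

variable {β : HBeta}

/-- **THE MARGIN ROAD ON THE ROWS**: `c : Rows S.β0` + rate + constant remainder ⟹ `BetaAvgAFH (m₀ − c₀θ^{k₀}(1+θ) − r) 0 γ₀ β`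
(= `betaAvgAFH_of_marginConst` with `hlist := c.hsmall`, `k₁ := c.k₀`). [folklore] -/
theorem betaAvgAFH_of_rows_margin (S : B12Beta.OneLoopSplit β) (c : Rows S.β0) {γ₀ binf c₀ θ r : ℝ} (hθ0 : 0 ≤ θ)
    (hθ1 : θ ≤ 1) (hconv : GeomRate S.β0 binf c₀ θ) (hrem : RemainderConst S γ₀ r) :
    BetaAvgAFH (((c.m₀ : ℚ) : ℝ) - c₀ * θ ^ c.k₀ * (1 + θ) - r) 0 γ₀ β :=
  betaAvgAFH_of_marginConst S hθ0 hθ1 hconv (fun k hk => c.hsmall k (Nat.lt_succ_of_le hk)) hrem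

/-- **THE MARGIN ROAD FROM THE CODE16 ANCHOR, ENGINE CONVENTION** (`code16SetE`): anchor row + rate + constant remainder ⟹
`BetaAvgAFH (lo − c₀·θ⁰·(1+θ) − r) 0 γ₀ β` — no `hk₂`. [folklore] -/
theorem betaAvgAFH_of_anchorCode16E_margin (S : B12Beta.OneLoopSplit β) {G : (Fin 4 → ℂ) → ℂ} {κ M : ℝ}
    (hb : S.β0 0 = (latticeKernel G 0).re) (h : StripRegularC G κ M) (hκ : 0 < κ) {N : ℕ} (hN : 1 ≤ N) [NeZero (4 * N)]
    {t rT : ℝ} (hT : ‖((code16SetE N).card : ℂ)⁻¹ * (∑ w ∈ code16SetE N, descend G (gridPt (4 * N) w)) - t‖ ≤ rT)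
    {A : ℝ} (hA : M * codeTheta (aliasRatioL1 κ N) ≤ A) (lo : ℚ) (hlo : ((lo : ℚ) : ℝ) ≤ t - rT - A)
    {γ₀ binf c₀ θ r : ℝ} (hθ0 : 0 ≤ θ) (hθ1 : θ ≤ 1) (hconv : GeomRate S.β0 binf c₀ θ) (hrem : RemainderConst S γ₀ r) :
    BetaAvgAFH (((lo : ℚ) : ℝ) - c₀ * θ ^ 0 * (1 + θ) - r) 0 γ₀ β := by
  have key := betaAvgAFH_of_rows_margin S (rowsOfCode16E hb h hκ hN hT hA lo hlo) hθ0 hθ1 hconv hrem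
  rwa [(rowsOfCode16E_consts hb h hκ hN hT hA lo hlo).2.2] at key

/-- … and the TREE convention (`code16Set`). [folklore] -/
theorem betaAvgAFH_of_anchorCode16_margin (S : B12Beta.OneLoopSplit β) {G : (Fin 4 → ℂ) → ℂ} {κ M : ℝ}
    (hb : S.β0 0 = (latticeKernel G 0).re) (h : StripRegularC G κ M) (hκ : 0 < κ) {N : ℕ} (hN : 1 ≤ N) [NeZero (4 * N)]
    {t rT : ℝ} (hT : ‖((code16Set N).card : ℂ)⁻¹ * (∑ w ∈ code16Set N, descend G (gridPt (4 * N) w)) - t‖ ≤ rT)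
    {A : ℝ} (hA : M * codeTheta (aliasRatioL1 κ N) ≤ A) (lo : ℚ) (hlo : ((lo : ℚ) : ℝ) ≤ t - rT - A)
    {γ₀ binf c₀ θ r : ℝ} (hθ0 : 0 ≤ θ) (hθ1 : θ ≤ 1) (hconv : GeomRate S.β0 binf c₀ θ) (hrem : RemainderConst S γ₀ r) :
    BetaAvgAFH (((lo : ℚ) : ℝ) - c₀ * θ ^ 0 * (1 + θ) - r) 0 γ₀ β := by
  have key := betaAvgAFH_of_rows_margin S (rowsOfCode16 hb h hκ hN hT hA lo hlo) hθ0 hθ1 hconv hrem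
  rwa [(rowsOfCode16_consts hb h hκ hN hT hA lo hlo).2.2] at key

end Margin


/-! ## §4 (v1.2, APPEND-ONLY) THE ROW'S TYPED TARGET IN ONE SIGNATURE: the code16 anchor on the ONE-LOOP FORM, structure ⊕ certificates

cap3-g8's `PolyRegularAlgebra` (p203603; «CONSUMER RECIPE» addressed to this lineage, journal l.3547) discharges the STRUCTURAL half of the
binder (Z) `StripRegularC G κ M` for `G` of one-loop form `t₁ − t₂ = tr(A⁻¹B) − tr(A⁻¹ C A′⁻¹ D)` from: `MatPolyHol` of the five matrix families
(entrywise poly-holomorphy — `matPolyHol_characterSum` for every stencil family `q ↦ Σ_{ΔR} K[ΔR] e^{iq·ΔR}`), (Z1) `det A ≠ 0`, `det A′ ≠ 0` on the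
closed polystrip (CERTIFICATE, CAP-KERNEL §7), and (Z2) a certified sup bound `M` (CERTIFICATE, uncomputed — CAP-KERNEL §4.10/§4.14).  Composed with
§1 this is THE ANCHOR ROW OF BINDER-OWNERS row CAP-k item (b) with every binder named by kind, and its certified-road END.  Nothing is
instantiated: the cell's actual families `A = k₀`, `A′ = k₀(· − p)`, `B, C, D` = vertex stencils live in the engines, not in Lean. -/

section OneLoopForm

open Summit.QuantumFields.BalabanUV.Beta.PolyRegularAlgebra (MatPolyHol stripRegularC_oneLoopForm)

variable {b : ℕ → ℝ} {n : Type*} [Fintype n] [DecidableEq n]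
variable {A A' B C D : (Fin 4 → ℂ) → Matrix n n ℂ} {κ M : ℝ}

/-- **THE ANCHOR ROW ON THE ONE-LOOP FORM (code16, engine convention).**  Binders by kind: (N) `hb` the level-0 DICTIONARY (row D1);
STRUCTURE `hA hA' hBst hBs hBt` (kernel-dischargeable once the stencil families are typed); (Z1) `hdet hdet'` (certificate); (Z2) `hM`
(certificate); (T) `hT` the two-engine ball for the mean over `code16SetE N`; (A) `hA₀` (kernel: `CapLatticeBudget.budget_code16_*`/`_param`);
cmp `hlo` (decidable) ⟹ `Rows b` with `k₀ = 0`, `lo 0 = lo`. [folklore] -/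
noncomputable def rowsOfOneLoopFormCode16E
    (hb : b 0 = (latticeKernel (fun p => ((A p)⁻¹ * B p).trace - ((A p)⁻¹ * C p * (A' p)⁻¹ * D p).trace) 0).re)
    (hκ : 0 < κ) (hA : MatPolyHol A (fun _ => κ)) (hA' : MatPolyHol A' (fun _ => κ)) (hBst : MatPolyHol B (fun _ => κ))
    (hBs : MatPolyHol C (fun _ => κ)) (hBt : MatPolyHol D (fun _ => κ))
    (hdet : ∀ p ∈ B4Strip.Strip (3 + 1) κ, (A p).det ≠ 0) (hdet' : ∀ p ∈ B4Strip.Strip (3 + 1) κ, (A' p).det ≠ 0)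
    (hM : ∀ p ∈ B4Strip.Strip (3 + 1) κ, ‖((A p)⁻¹ * B p).trace - ((A p)⁻¹ * C p * (A' p)⁻¹ * D p).trace‖ ≤ M)
    {N : ℕ} (hN : 1 ≤ N) [NeZero (4 * N)] {t r : ℝ}
    (hT : ‖((code16SetE N).card : ℂ)⁻¹ *
        (∑ w ∈ code16SetE N, descend (fun p => ((A p)⁻¹ * B p).trace - ((A p)⁻¹ * C p * (A' p)⁻¹ * D p).trace)
          (gridPt (4 * N) w)) - t‖ ≤ r)
    {A₀ : ℝ} (hA₀ : M * codeTheta (aliasRatioL1 κ N) ≤ A₀) (lo : ℚ) (hlo : ((lo : ℚ) : ℝ) ≤ t - r - A₀) : Rows b :=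
  rowsOfCode16E hb (stripRegularC_oneLoopForm hκ.le hA hA' hBst hBs hBt hdet hdet' hM) hκ hN hT hA₀ lo hlo

variable {β : HBeta}

/-- **THE CERTIFIED ROAD FROM THE ONE-LOOP-FORM ANCHOR** — the typed target of row CAP-k in ONE signature: the binders of
`rowsOfOneLoopFormCode16E` (with `b := S.β0`) + rate `GeomRate S.β0 binf c₀ θ` (`0 ≤ θ ≤ 1`) + `hk₂` at `k₀ = 0` + `RemainderConst S γ₀ r′` ⟹
`BetaAvgAFH (min lo (3(lo − c₀)/4) − r′) 0 γ₀ β`.  0 of these binders is instantiated in the tree. [folklore] -/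
theorem betaAvgAFH_of_oneLoopFormCode16E (S : B12Beta.OneLoopSplit β)
    (hb : S.β0 0 = (latticeKernel (fun p => ((A p)⁻¹ * B p).trace - ((A p)⁻¹ * C p * (A' p)⁻¹ * D p).trace) 0).re)
    (hκ : 0 < κ) (hA : MatPolyHol A (fun _ => κ)) (hA' : MatPolyHol A' (fun _ => κ)) (hBst : MatPolyHol B (fun _ => κ))
    (hBs : MatPolyHol C (fun _ => κ)) (hBt : MatPolyHol D (fun _ => κ))
    (hdet : ∀ p ∈ B4Strip.Strip (3 + 1) κ, (A p).det ≠ 0) (hdet' : ∀ p ∈ B4Strip.Strip (3 + 1) κ, (A' p).det ≠ 0)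
    (hM : ∀ p ∈ B4Strip.Strip (3 + 1) κ, ‖((A p)⁻¹ * B p).trace - ((A p)⁻¹ * C p * (A' p)⁻¹ * D p).trace‖ ≤ M)
    {N : ℕ} (hN : 1 ≤ N) [NeZero (4 * N)] {t rT : ℝ}
    (hT : ‖((code16SetE N).card : ℂ)⁻¹ *
        (∑ w ∈ code16SetE N, descend (fun p => ((A p)⁻¹ * B p).trace - ((A p)⁻¹ * C p * (A' p)⁻¹ * D p).trace)
          (gridPt (4 * N) w)) - t‖ ≤ rT)
    {A₀ : ℝ} (hA₀ : M * codeTheta (aliasRatioL1 κ N) ≤ A₀) (lo : ℚ) (hlo : ((lo : ℚ) : ℝ) ≤ t - rT - A₀)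
    {γ₀ binf c₀ θ r : ℝ} (hθ0 : 0 ≤ θ) (hθ1 : θ ≤ 1) (hconv : GeomRate S.β0 binf c₀ θ)
    (hk₂ : c₀ * θ ^ (0 + 1) ≤ ((lo : ℝ) - c₀ * θ ^ 0) / 4) (hrem : RemainderConst S γ₀ r) :
    BetaAvgAFH (min ((lo : ℚ) : ℝ) (3 * ((lo : ℝ) - c₀ * θ ^ 0) / 4) - r) 0 γ₀ β :=
  betaAvgAFH_of_anchorCode16E S hb (stripRegularC_oneLoopForm hκ.le hA hA' hBst hBs hBt hdet hdet' hM) hκ hN hT hA₀ lo hlo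
    hθ0 hθ1 hconv hk₂ hrem

end OneLoopForm

end Summit.QuantumFields.BalabanUV.Beta.CapRowsLattice
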